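import Summits.CriticalPhenomena.SAWScalingLimit.Theorems.SAWLoopFugacityFlowIsingBoundaryRatioRimRectRotation
import Summits.CriticalPhenomena.SAWScalingLimit.Theorems.SAWLoopFugacityFlowIsingBoundaryRatioWindowRectDefs
import Literature.Probability.LatticeModels.FKIsingAnnulusTopRect
import HarnessLib

/-!
# The wired local measure of the annulus is dominated, on open crossings of the window rectangle, by the
# fully wired measure of the rectangle (line `fk-anchor-transfer`, crux `SAWLoopFugacityFlow.IsingBoundaryRatio`,
# stmt-CriticalPhenomena-10650; helper of the rim-to-rim instance `halfAnnulusRimCrossingBoundLarge_of'`)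

Let `Λ` be a finite volume, `H` a nearest-neighbour graph on `↥Λ` (every edge is a lattice edge), `Ann ⊆ Λ` and
`U = annEdgeFinset H Ann` the edges of `H` touching `Ann`; let `E` be a finite set of lattice edges whose endpoints
lie in `Λ`, are joined in `H`, and belong to `Ann`. Then for the critical FK-Ising measure `φ^{Annᶜ}_{⟨U⟩}` (all
vertices off the annulus wired) and any two vertex sets `A, C ⊆ verts E`, the probability that `⟨E⟩` contains an
open walk from `A` to `C` is at most the probability of the open crossing `{A ↔ C}` under the random-cluster
measure of `⟨E⟩` on its own vertex type with ALL its boundary vertices `∂E` wired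
(`real_walkEvent_le_fkMeasure_rim`). Printed route (Duminil-Copin–Smirnov 2012, Thm 3.1 and §3.2; Grimmett 2006,
Lemma 4.13, 4.14), as formalised for square annuli in `FKIsingAnnulusTopRect.lean`
(`real_annulusTopCrossing_le_wiredTopRect`):
* comparison of boundary conditions (`rcMeasure_real_mono_wired_of_isUpperSet`): enlarge the wired set `Annᶜ` to
  `W' = ∂E ∪ (Λ ∖ verts E)` — every vertex of `E` carrying an edge of `U ∖ E` is a boundary vertex of `E`, because
  the edges of `H` are lattice edges;
* domain Markov (`rcMeasure_real_eq_fromEdgeSet_of_outside_wired`): the edges of `U ∖ E` join wired vertices and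
  integrate out;
* transfer to the vertex type of `E` (`rcMeasure_real_map_of_wired`, `map_image_mem_openCrossing_iff`).
-/

noncomputable section

open scoped Classical
open Set SimpleGraph MeasureTheory
open Literature.Probability.LatticeModels
open Literature.Probability.Percolation

namespace Summit.CriticalPhenomena.SAWScalingLimit.Theorems.IsingBoundaryRatio

/-- An `ω`-open walk of `⟨E⟩` (edges read in `Λ`) between vertices of `E` is an open connection, inside the range
of an inclusion `j : verts E ↪ Λ`, of the configuration `ω` restricted to the lifted edges of `⟨E⟩`. [folklore] -/
theorem openConnIn_of_walk_rim {Λ : Finset (Site 2)} {E : Finset (Sym2 (Site 2))}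
    (j : ↥((DiscreteRect.verts E : Finset (Site 2)) : Set (Site 2)) ↪ Λ) (hj : ∀ x, (j x).1 = x.1)
    (ω : BondConfig Λ) {u v : Site 2} (p : (fromEdgeSet (↑E : Set (Sym2 (Site 2)))).Walk u v)
    (hp : ∀ e ∈ p.edges, ∃ (x y : Site 2) (hx : x ∈ Λ) (hy : y ∈ Λ),
      e = s(x, y) ∧ s((⟨x, hx⟩ : Λ), ⟨y, hy⟩) ∈ ω)
    (hu : u ∈ DiscreteRect.verts E) (hv : v ∈ DiscreteRect.verts E) :
    ω ∩ ↑((DiscreteRect.graph E).edgeFinset.map j.sym2Map) ∈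
      openConnIn (Set.range j) (j ⟨u, hu⟩) (j ⟨v, hv⟩) := by
  induction p with
  | nil => exact openConnIn_refl ⟨_, rfl⟩
  | @cons a b c hadj q ih =>
    rw [fromEdgeSet_adj, Finset.mem_coe] at hadj
    have hb : b ∈ DiscreteRect.verts E := mem_verts_of_mem_right_rim hadj.1
    have ih' := ih (fun e he => hp e (by rw [Walk.edges_cons]; exact List.mem_cons_of_mem _ he)) hb hv
    refine PlanarDuality.openConnIn_trans (openConnIn_of_adj ⟨_, rfl⟩ ⟨_, rfl⟩ ?_ ?_) ih'
    · obtain ⟨x, y, hx, hy, hexy, hω⟩ := hp s(a, b) (by rw [Walk.edges_cons]; exact List.mem_cons_self)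
      refine ⟨?_, ?_⟩
      · have : s(j ⟨a, hu⟩, j ⟨b, hb⟩) = s((⟨x, hx⟩ : Λ), ⟨y, hy⟩) := by
          rcases Sym2.eq_iff.1 hexy with ⟨rfl, rfl⟩ | ⟨rfl, rfl⟩
          · congr 1 <;> exact Subtype.ext (hj _)
          · rw [Sym2.eq_swap]
            congr 1 <;> exact Subtype.ext (hj _)
        rw [this]
        exact hω
      · rw [Finset.mem_coe, Finset.mem_map]
        refine ⟨s(⟨a, hu⟩, ⟨b, hb⟩), ?_, by rw [Function.Embedding.sym2Map_apply, Sym2.map_mk]⟩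
        rw [mem_edgeFinset, mem_edgeSet]
        show (fromEdgeSet (↑E : Set (Sym2 (Site 2)))).Adj a b
        rw [fromEdgeSet_adj, Finset.mem_coe]
        exact hadj
    · intro h
      have := congrArg Subtype.val h
      rw [hj, hj] at this
      exact hadj.2 this

/-- **The wired local measure is dominated on open crossings of `⟨E⟩` by the fully wired measure of `⟨E⟩`**
(see the module docstring): comparison of boundary conditions, domain Markov, transfer of vertex types.
[cite: DuminilCopinSmirnov2012Clay, Thm. 3.1 and §3.2] -/
theorem real_walkEvent_le_fkMeasure_rim : ∀ {Λ : Finset (Site 2)} (H : SimpleGraph Λ) (Ann : Set Λ) (E : Finset (Sym2 (Site 2))) (hsub : DiscreteRect.verts E ⊆ Λ), (∀ (x y : Site 2) (hx : x ∈ Λ) (hy : y ∈ Λ), s(x, y) ∈ E → H.Adj ⟨x, hx⟩ ⟨y, hy⟩) → (∀ (x : Site 2) (hx : x ∈ DiscreteRect.verts E), (⟨x, hsub hx⟩ : Λ) ∈ Ann) → (∀ u v : Λ, H.Adj u v → ∃ k : Fin 4, v.1 = u.1 + DiscreteRect.dir k) → (∃ x ∈ DiscreteRect.verts E, x ∈ DiscreteRect.bdVerts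 E) → ∀ {A C : Set (Site 2)}, A ⊆ ↑(DiscreteRect.verts E) → C ⊆ ↑(DiscreteRect.verts E) → (rcMeasure (SimpleGraph.fromEdgeSet (↑(annEdgeFinset H Ann) : Set (Sym2 Λ))) criticalFKIsingParam 2 Annᶜ).real {ω | ∃ u ∈ A, ∃ v ∈ C, ∃ p : (SimpleGraph.fromEdgeSet (↑E : Set (Sym2 (Site 2)))).Walk u v, ∀ e ∈ p.edges, ∃ (x y : Site 2) (hx : x ∈ Λ) (hy : y ∈ Λ), e = s(x, y) ∧ s((⟨x, hx⟩ : Λ), ⟨y, hy⟩) ∈ ω} ≤ (DiscreteRect.fkMeasure E {x | x.1 ∈ DiscreteRect.bdVerts E}).real (Literature.Probability.Percolation.openCrossing Set.univ {x | x.1 ∈ A} {x | x.1 ∈ C}) := by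
  intro Λ H Ann E hsub hadj hann hlat hbd A C hA hC
  have hp : criticalFKIsingParam ∈ Set.Icc (0 : ℝ) 1 := criticalFKIsingParam_mem_Icc
  -- the inclusion of vertex types
  obtain ⟨j, hj⟩ : ∃ j : ↥((DiscreteRect.verts E : Finset (Site 2)) : Set (Site 2)) ↪ Λ, ∀ x, (j x).1 = x.1 :=
    ⟨⟨fun x => ⟨x.1, hsub x.2⟩, fun a b h => Subtype.ext (by simpa using congrArg Subtype.val h)⟩, fun _ => rfl⟩
  have hjeq : ∀ x, j x = ⟨x.1, hsub x.2⟩ := fun x => Subtype.ext (hj x)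
  have hjAnn : ∀ x, j x ∈ Ann := fun x => by
    rw [hjeq]
    exact hann x.1 x.2
  -- the graphs (`G` kept opaque, so that only the generic instances apply to it)
  set U : Finset (Sym2 Λ) := annEdgeFinset H Ann with hU
  obtain ⟨G, hGdef⟩ : ∃ G : SimpleGraph Λ, G = fromEdgeSet (↑U : Set (Sym2 Λ)) := ⟨_, rfl⟩
  let G₀ := DiscreteRect.graph E
  have hG₀ : ∀ a b : ↥((DiscreteRect.verts E : Finset (Site 2)) : Set (Site 2)),
      G₀.Adj a b ↔ s(a.1, b.1) ∈ E ∧ a.1 ≠ b.1 := by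
    intro a b
    show (fromEdgeSet (↑E : Set (Sym2 (Site 2)))).Adj a.1 b.1 ↔ _
    rw [fromEdgeSet_adj, Finset.mem_coe]
  have hG : ∀ u v : Λ, G.Adj u v ↔ (H.Adj u v ∧ ∃ w ∈ Ann, w ∈ s(u, v)) ∧ u ≠ v := by
    intro u v
    rw [hGdef, fromEdgeSet_adj, Finset.mem_coe, hU, mem_annEdgeFinset, mem_edgeSet]
  -- the lifted edges of `⟨E⟩` (kept opaque: instance search must not unfold it)
  obtain ⟨E', hE'def⟩ : ∃ E' : Finset (Sym2 Λ), E' = G₀.edgeFinset.map j.sym2Map := ⟨_, rfl⟩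
  have hF : E' ⊆ G.edgeFinset := by
    intro e he
    rw [hE'def] at he
    obtain ⟨e₀, he₀, rfl⟩ := Finset.mem_map.1 he
    induction e₀ using Sym2.ind with
    | h a b =>
      rw [mem_edgeFinset, mem_edgeSet, hG₀] at he₀
      rw [Function.Embedding.sym2Map_apply, Sym2.map_mk, mem_edgeFinset, mem_edgeSet, hG]
      refine ⟨⟨?_, j a, hjAnn a, Sym2.mem_mk_left _ _⟩, fun h => he₀.2 ?_⟩
      · rw [hjeq, hjeq]
        exact hadj a.1 b.1 _ _ he₀.1
      · rw [← hj a, ← hj b, h]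
  -- the wired sets
  let W : Set ↥((DiscreteRect.verts E : Finset (Site 2)) : Set (Site 2)) := {x | x.1 ∈ DiscreteRect.bdVerts E}
  let W' : Set Λ := {u | ∀ x, j x = u → x ∈ W}
  have hW'iff : ∀ u, u ∈ W' ↔ ∀ x, j x = u → x ∈ W := fun _ => Iff.rfl
  have hWne : W.Nonempty := by
    obtain ⟨x, hx, hxb⟩ := hbd
    exact ⟨⟨x, hx⟩, hxb⟩
  have hAnnW' : Annᶜ ⊆ W' := by
    intro u hu x hxu
    exact absurd (hxu ▸ hjAnn x) hu
  -- every vertex of `E` carrying an edge of `U ∖ E'` is a boundary vertex of `E`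
  have hW'mem : ∀ u v : Λ, G.Adj u v → s(u, v) ∉ E' → u ∈ W' := by
    intro u v huv hnot x hxu
    rw [hG] at huv
    obtain ⟨⟨hH, -⟩, hne⟩ := huv
    obtain ⟨k, hk⟩ := hlat u v hH
    have hxu' : x.1 = u.1 := by rw [← hxu, hj]
    refine ⟨k, x.2, fun hmem => hnot ?_⟩
    have hv : v.1 ∈ DiscreteRect.verts E := by
      rw [hk, ← hxu']
      exact mem_verts_of_mem_right_rim hmem
    rw [hE'def]
    refine Finset.mem_map.2 ⟨s(x, ⟨v.1, hv⟩), ?_, ?_⟩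
    · rw [mem_edgeFinset, mem_edgeSet, hG₀]
      refine ⟨?_, fun h => hne (Subtype.ext (hxu'.symm.trans h))⟩
      show s(x.1, v.1) ∈ E
      rw [hk, ← hxu']
      exact hmem
    · rw [Function.Embedding.sym2Map_apply, Sym2.map_mk, hxu]
      congr 1
      exact Subtype.ext (hj _)
  have hB : ∀ e ∈ G.edgeFinset, e ∉ E' → ∀ x ∈ e, x ∈ W' := by
    intro e he hnot
    induction e using Sym2.ind with
    | h u v =>
      have huv : G.Adj u v := mem_edgeFinset.1 he
      intro x hx
      rcases Sym2.mem_iff.1 hx with rfl | rfl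
      · exact hW'mem _ v huv hnot
      · exact hW'mem _ u huv.symm (by rwa [Sym2.eq_swap])
  -- the events
  let A₀ : Set ↥((DiscreteRect.verts E : Finset (Site 2)) : Set (Site 2)) := {x | x.1 ∈ A}
  let C₀ : Set ↥((DiscreteRect.verts E : Finset (Site 2)) : Set (Site 2)) := {x | x.1 ∈ C}
  let A' : Set (BondConfig Λ) := {ω | ω ∩ ↑E' ∈ openCrossing (j '' Set.univ) (j '' A₀) (j '' C₀)}
  have hA'up : IsUpperSet A' := by
    intro ω ω' hle hω
    exact isUpperSet_openCrossing _ _ _ (Set.inter_subset_inter_left _ hle) hω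
  have hAiff : ∀ ω : Finset (Sym2 Λ), ω ⊆ G.edgeFinset →
      ((↑ω : BondConfig Λ) ∈ A' ↔ (↑(ω ∩ E') : BondConfig Λ) ∈ A') := by
    intro ω _
    show ((↑ω : BondConfig Λ) ∩ (↑E' : Set (Sym2 Λ)) ∈ openCrossing (j '' Set.univ) (j '' A₀) (j '' C₀)) ↔
      ((↑(ω ∩ E') : BondConfig Λ) ∩ (↑E' : Set (Sym2 Λ)) ∈ openCrossing (j '' Set.univ) (j '' A₀) (j '' C₀))
    rw [Finset.coe_inter, Set.inter_assoc, Set.inter_self]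
  have hAA' : ∀ ω : Finset (Sym2 ↥((DiscreteRect.verts E : Finset (Site 2)) : Set (Site 2))),
      ω ⊆ G₀.edgeFinset →
      ((↑ω : BondConfig _) ∈ openCrossing Set.univ A₀ C₀ ↔ (↑(ω.map j.sym2Map) : BondConfig Λ) ∈ A') := by
    intro ω hω
    show _ ↔ ((↑(ω.map j.sym2Map) : BondConfig Λ) ∩ (↑E' : Set (Sym2 Λ)) ∈
      openCrossing (j '' Set.univ) (j '' A₀) (j '' C₀))
    have hsubE' : ω.map j.sym2Map ⊆ E' := by
      rw [hE'def]
      exact Finset.map_subset_map.2 hω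
    rw [Set.inter_eq_left.2 (Finset.coe_subset.2 hsubE'), coe_map_sym2Map, map_image_mem_openCrossing_iff]
  -- the walk event is contained in `A'`
  have hS : {ω : BondConfig Λ | ∃ u ∈ A, ∃ v ∈ C, ∃ p : (fromEdgeSet (↑E : Set (Sym2 (Site 2)))).Walk u v,
      ∀ e ∈ p.edges, ∃ (x y : Site 2) (hx : x ∈ Λ) (hy : y ∈ Λ),
        e = s(x, y) ∧ s((⟨x, hx⟩ : Λ), ⟨y, hy⟩) ∈ ω} ⊆ A' := by
    rintro ω ⟨u, huA, v, hvC, p, hpω⟩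
    have hu : u ∈ DiscreteRect.verts E := hA huA
    have hv : v ∈ DiscreteRect.verts E := hC hvC
    refine ⟨j ⟨u, hu⟩, ⟨⟨u, hu⟩, huA, rfl⟩, j ⟨v, hv⟩, ⟨⟨v, hv⟩, hvC, rfl⟩, ?_⟩
    rw [Set.image_univ, hE'def]
    exact openConnIn_of_walk_rim j hj ω p hpω hu hv
  -- assembly
  haveI := isProbabilityMeasure_rcMeasure G hp two_pos Annᶜ
  have key : (rcMeasure G criticalFKIsingParam 2 Annᶜ).real {ω : BondConfig Λ | ∃ u ∈ A, ∃ v ∈ C,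
      ∃ p : (fromEdgeSet (↑E : Set (Sym2 (Site 2)))).Walk u v,
      ∀ e ∈ p.edges, ∃ (x y : Site 2) (hx : x ∈ Λ) (hy : y ∈ Λ),
        e = s(x, y) ∧ s((⟨x, hx⟩ : Λ), ⟨y, hy⟩) ∈ ω} ≤
      (DiscreteRect.fkMeasure E W).real (openCrossing Set.univ A₀ C₀) :=
    calc (rcMeasure G criticalFKIsingParam 2 Annᶜ).real _
        ≤ (rcMeasure G criticalFKIsingParam 2 Annᶜ).real A' := measureReal_mono hS
      _ ≤ (rcMeasure G criticalFKIsingParam 2 W').real A' :=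
          rcMeasure_real_mono_wired_of_isUpperSet G hp one_le_two hAnnW' hA'up
      _ = (rcMeasure (fromEdgeSet (↑E' : Set (Sym2 Λ))) criticalFKIsingParam 2 W').real A' :=
          rcMeasure_real_eq_fromEdgeSet_of_outside_wired G hp two_pos W' E' hF hB hAiff
      _ = (rcMeasure G₀ criticalFKIsingParam 2 W).real (openCrossing Set.univ A₀ C₀) :=
          rcMeasure_real_map_of_wired (G := G₀) (G' := fromEdgeSet (↑E' : Set (Sym2 Λ))) j
            ((@edgeFinset_fromEdgeSet_of_subset _ _ G _ E' hF (fintypeEdgeSet _)).trans hE'def)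
            hp two_pos hWne hW'iff hAA'
      _ = _ := rfl
  subst hGdef
  convert key using 4

end Summit.CriticalPhenomena.SAWScalingLimit.Theorems.IsingBoundaryRatio

end
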